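import Literature.AnabelianGeometry.SemiGraphs.ThetaRayMaximalCompactEscaping
import Literature.AnabelianGeometry.SemiGraphs.ThetaRayEscapeCoincidence
import Literature.AnabelianGeometry.SemiGraphs.ThetaRayGraphFreeProP
import Literature.AnabelianGeometry.SemiGraphs.FreeProPRankTwoGluing
import Literature.AnabelianGeometry.SemiGraphs.ThetaRayFreeProP
import Literature.AnabelianGeometry.SemiGraphs.ThetaRayFreeProPQuasiCoherent
import Literature.AnabelianGeometry.SemiGraphs.FreeProPRankTwoLevels
import Literature.AnabelianGeometry.SemiGraphs.TemperedLevelKernelCharOpenCore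
import HarnessLib

/-!
# The escaping procyclic `C ≅ ℤ_p` of `π₁^temp(𝒢_θ(p, n))` is a maximal compact subgroup lying in no verticial
# subgroup ([SemiAnbd] Thm 3.7 (iii)/(iv) p. 41 at abc-iut-L3-d1's countermodel; character form and
# instantiation)

Mochizuki, *Semi-graphs of anabelioids*, Publ. RIMS **42** (2006) [MochizukiSemiAnbd2006], §3, Theorem 3.7
(iii)/(iv), author's manuscript pp. 40–41 [cite: MochizukiSemiAnbd2006, Thm 3.7(iv) p.41]; the printed proof
concerns FINITE underlying semi-graphs (kernel: `compactInVerticialAt_of_finiteGraph`,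
`maximalCompactIffVerticialAt_of_finiteGraph`).

PROOF-ONLY file (abc-iut cell, F-wave seat abc-iut-f-175 gen 2; 0 definitions, no named fact, no hypothesis
beyond `Fact p.Prime`).  Companion of `ThetaRayMaximalCompactEscaping.lean`:

* `thetaRay_exists_maximalCompact_escaping_of_characters` — the binder form over abc-iut-L3-d4's character data
  (`thetaRay_hcrit_of_characters`), same binders as `thetaRay_not_compactInVerticialAt_of_characters`
  (p441714) plus `E = closure⟨e₀⟩`;
* `ProfiniteSemiGraph.thetaRayFreeProP_exists_maximalCompact_escaping (p) (n) (hn : ∀ k, k ≤ n k)` — at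
  `𝒢_θ(p, n)` (`G = F̂₂⁽ᵖ⁾`, `E = ℤ_p`, `e₀ = 1`; the instantiation block of abc-iut-L3-d4's
  `ThetaRayRefutation.lean` VERBATIM): a continuous `ζ : ℤ_p →ₜ* π₁^temp(𝒢_θ)` (canonical chart) whose range
  is a MAXIMAL compact subgroup of `π₁^temp(𝒢_θ)` contained in NO verticial subgroup.

This is the input of the kernel decision of the ∀-countable typed forms of [SemiAnbd] Cor 3.9 (F-2770
`QuasiGeometricGraphDataCompat`, F-2771 `Cor39Compat`): a homomorphism from a one-vertex graph of anabelioids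
ONTO this maximal compact subgroup is (compatibly) quasi-geometric as typed, yet compatible with no morphism of
semi-graphs of anabelioids.  HONEST FRAMING: erratum-grade, about the ∀-countable TYPING (finite graphs:
positive kernel theorems); nothing here bears on [IUTchIII] Cor. 3.12.
-/

noncomputable section

namespace Literature.AnabelianGeometry.SemiGraphs

open CategoryTheory Topology Multiplicative
open ProfiniteSemiGraph ProfiniteSemiGraph.GaloisLevelData

/-! ### Generic ray of groups: the character form -/

section Generic

variable {G E : Type} [Group G] [TopologicalSpace G] [IsTopologicalGroup G] [CompactSpace G]
  [TotallyDisconnectedSpace G] [Group E] [TopologicalSpace E] [IsTopologicalGroup E] [CompactSpace E]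
  [TotallyDisconnectedSpace E] {up : E →ₜ* G} {low : ℕ → (E →ₜ* G)}
  {A V : ℕ → Type} [∀ n, CommGroup (A n)] [∀ n, TopologicalSpace (A n)] [∀ n, DiscreteTopology (A n)]
  [∀ n, Finite (A n)] [∀ n, CommGroup (V n)]

/-- **The escaping procyclic `C` of `𝒢_θ` is a MAXIMAL compact subgroup lying in no verticial subgroup**, from
level CHARACTER data — binders as in abc-iut-L3-d4's `thetaRay_not_compactInVerticialAt_of_characters`:
`Thm37Hypotheses`, a base point sequence `P₀`, (hcoin), `χG`/`ab`/(hK)/(hsep) producing (hcrit), plus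
`E = closure⟨e₀⟩`. [cite: MochizukiSemiAnbd2006, Thm 3.7(iv) p.41] -/
theorem thetaRay_exists_maximalCompact_escaping_of_characters (h37 : (thetaRay G E up low).Thm37Hypotheses)
    (P₀ : ((thetaRay G E up low).galoisLevelData h37.toProp36Hypotheses).PointSeq h37.isCountable (0 : ℕ))
    (e₀ : E) (hgen : (Subgroup.zpowers e₀).topologicalClosure = ⊤)
    (hcoin : ∀ d : ℕ, ∃ N : ℕ, ∀ k, N ≤ k → (low (k + 1) e₀)⁻¹ * up e₀ ∈ charOpenCore G d)
    (χG : ∀ n, G →ₜ* A n) (hχA : ∀ (n k : ℕ) (t : E), χG n (low k t) = χG n (up t))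
    (ab : ∀ n, G →* V n)
    (hK : ∀ n : ℕ, ∃ j₀ : ℕ, ∀ j, j₀ ≤ j → ∀ (w : ℕ)
      (P : ((thetaRay G E up low).galoisLevelData h37.toProp36Hypotheses).PointSeq h37.isCountable w)
      (x : G), P.gal j x = 1 → ab n x = 1)
    (hsep : ∀ (n : ℕ) (t₁ t₂ : E), χG n (low (n + 1) t₁) = χG n (up e₀) → χG n (up t₂) = χG n (up e₀) →
      ab n (low (n + 1) t₁) ≠ ab n (up t₂)) :
    ∃ ζ : E →ₜ* ((thetaRay G E up low).temperedPiChart h37.toProp36Hypotheses).G,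
      IsMaximalCompactSubgroup ζ.toMonoidHom.range ∧
      ¬ ∃ (v : ℕ) (H : Subgroup ((thetaRay G E up low).temperedPiChart h37.toProp36Hypotheses).G),
          H ∈ verticialSubgroups ((thetaRay G E up low).temperedPiChart h37.toProp36Hypotheses) v ∧
          ζ.toMonoidHom.range ≤ H :=
  thetaRay_exists_maximalCompact_escaping_of_hcrit h37 P₀ e₀ hgen hcoin
    (thetaRay_hcrit_of_characters h37.toProp36Hypotheses P₀ e₀ χG hχA ab hK hsep)

end Generic

/-! ### The countermodel `𝒢_θ(p, n)` -/

namespace ProfiniteSemiGraph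

open Literature.AnabelianGeometry.SemiGraphs.FreeProPRankTwo

variable (p : ℕ) [hp : Fact p.Prime] (n : ℕ → ℕ)

/-- **At `𝒢_θ(p, n)` (`k ≤ n k`): a continuous `ζ : ℤ_p →ₜ* π₁^temp(𝒢_θ)` (canonical chart) whose range —
the escaping compact procyclic `C = closure⟨c⟩` of abc-iut-L3-d4's `thetaRayFreeProP_not_compactInVerticialAt` —
is a MAXIMAL compact subgroup contained in NO verticial subgroup.**  Script: the instantiation block of
`ThetaRayRefutation.lean` verbatim (bricks R1–R5, L3-t6's level kernels, the characters `χaMod`, the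
abelianisations `abMod`), with the closer of the companion file. [cite: MochizukiSemiAnbd2006, Thm 3.7(iv) p.41] -/
theorem thetaRayFreeProP_exists_maximalCompact_escaping (hn : ∀ k, k ≤ n k) :
    ∃ (h36 : (thetaRayFreeProP p n).Prop36Hypotheses)
      (ζ : Multiplicative ℤ_[p] →ₜ* ((thetaRayFreeProP p n).temperedPiChart h36).G),
      (thetaRayFreeProP p n).Thm37Hypotheses ∧
      IsMaximalCompactSubgroup ζ.toMonoidHom.range ∧
      ¬ ∃ (v : ℕ) (H : Subgroup ((thetaRayFreeProP p n).temperedPiChart h36).G),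
          H ∈ verticialSubgroups ((thetaRayFreeProP p n).temperedPiChart h36) v ∧
          ζ.toMonoidHom.range ≤ H := by
  classical
  haveI : NeZero p := ⟨hp.out.ne_zero⟩
  -- `Thm37Hypotheses 𝒢_θ(p, n)` unconditionally (bricks R1–R5; as in abc-iut-L3-d4's refutation script)
  have h37 : (thetaRayFreeProP p n).Thm37Hypotheses :=
    thetaRayFreeProP_thm37Hypotheses p n
      (thetaRayFreeProP_isGaloisCountable p (α p) (α_ofAdd_one p) (fun m => θHom p m)
        (fun m => (θ p m).bijective) n)
      (thetaRayFreeProP_isQuasiCoherent p (α p) (α_ofAdd_one p) (fun m => θHom p m)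
        (fun m => (θ p m).bijective) n)
      (thetaRayFreeProP_isTotallyElevated_concrete p n)
      (thetaRayFreeProP_isTotallyAloof_concrete p n)
      (thetaRayFreeProP_isTotallyEstranged_concrete p n)
  have h36 : (thetaRayFreeProP p n).Prop36Hypotheses := h37.toProp36Hypotheses
  -- a base point sequence over `v_0`
  obtain ⟨P₀⟩ := thetaRay_nonempty_pointSeq_zero (G := Grp p) (E := Multiplicative ℤ_[p]) (up := α p)
    (low := fun k => θα p (n k)) h36
  -- strict coherence (for abc-iut-L3-t6's level kernels)
  have hsc : (thetaRayFreeProP p n).IsStrictlyCoherent :=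
    thetaRayFreeProP_isStrictlyCoherent p (α p) (α_ofAdd_one p) (fun m => θHom p m)
      (fun m => (θ p m).bijective) n
  -- (hcoin): `(θ_{n(k+1)} a)⁻¹ a = b^{-p^{n(k+1)}} → 1` through the characteristic open cores
  have hcoin : ∀ d : ℕ, ∃ N : ℕ, ∀ k, N ≤ k →
      ((fun k => θα p (n k)) (k + 1) (ofAdd (1 : ℤ_[p])))⁻¹ * α p (ofAdd 1) ∈ charOpenCore (Grp p) d :=
    thetaRayOfTwists_hcoin (α := α p) (θ := fun m => θHom p m) (n := n) (ofAdd (1 : ℤ_[p])) (b := b p)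
      (p := p) (fun m => by rw [α_ofAdd_one, θHom_apply, θ_a]) hn
      (fun d => exists_pow_prime_pow_mem p _ (FreeProPRankTwo.isOpen_charOpenCore p d) (b p))
  -- the level data: characters `χaMod (e m)`, abelianisations `abMod (e m)`, `e m := n (m+1) + 1`
  obtain ⟨ζ, hmax, hnv⟩ : ∃ ζ : Multiplicative ℤ_[p] →ₜ* ((thetaRayFreeProP p n).temperedPiChart h36).G,
      IsMaximalCompactSubgroup ζ.toMonoidHom.range ∧
      ¬ ∃ (v : ℕ) (H : Subgroup ((thetaRayFreeProP p n).temperedPiChart h36).G),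
          H ∈ verticialSubgroups ((thetaRayFreeProP p n).temperedPiChart h36) v ∧
          ζ.toMonoidHom.range ≤ H := by
    refine thetaRay_exists_maximalCompact_escaping_of_characters (G := Grp p)
      (E := Multiplicative ℤ_[p]) (up := α p) (low := fun k => θα p (n k))
      (A := fun m => Multiplicative (ZMod (p ^ (n (m + 1) + 1))))
      (V := fun m => Multiplicative (ZMod (p ^ (n (m + 1) + 1)) × ZMod (p ^ (n (m + 1) + 1))))
      h37 P₀ (ofAdd 1) (topologicalClosure_zpowers_ofAdd_one p) hcoin
      (fun m => χaMod p (n (m + 1) + 1)) ?_ (fun m => (abMod p (n (m + 1) + 1)).toMonoidHom) ?_ ?_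
    · -- hχA: the characters are compatible with the gluings (`χaMod` is `θ`-invariant)
      intro m k t
      change χaMod p _ (θ p (n k) (α p t)) = χaMod p _ (α p t)
      rw [χaMod_θ]
    · -- hK: at deep levels the point stabilisers lie in the characteristic core `⊆ ker (abMod e)` (L3-t6)
      intro m
      obtain ⟨j₀, hj₀⟩ := (thetaRayFreeProP p n).exists_level_hK h36 hsc (p ^ (2 * (n (m + 1) + 1)))
      exact ⟨j₀, fun j hj w P x hx =>
        hj₀ j hj w P (abMod p (n (m + 1) + 1)).toMonoidHom (charOpenCore_le_ker_abMod p _) x hx⟩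
    · -- hsep: the model arithmetic `(u, p^{n_{m+1}} u) ≠ (u, 0)` in `(ℤ/p^e)²`, `n_{m+1} < e`
      intro m t₁ t₂ h₁ h₂
      exact abMod_θ_α_ne_abMod_α_of_lt p (Nat.lt_succ_self _) t₁ t₂ h₁ h₂
  exact ⟨h36, ζ, h37, hmax, hnv⟩

end ProfiniteSemiGraph

end Literature.AnabelianGeometry.SemiGraphs

end
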